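import Literature.NumberTheory.EllipticCurves.LambdaAdicSelmerDataLevelProofs
import Literature.NumberTheory.EllipticCurves.CompactSelmerKummerDescent
import Literature.NumberTheory.EllipticCurves.HeegnerFamilyScalingProofs
import HarnessLib

/-!
# Division by `p^a` in `𝔖_p(K_∞)`: the compact Selmer families have no `p`-torsion when `E(L)[p] = 0`
# (helper for crux `PrintX9.HowardContainmentLightFrameOfPrint`, stmt-BirchSwinnertonDyer-25235,
# line `torsion-depth-light-ofprint`, stub `stub_depthPos_muPart`; part I of III)

Summits-side helper (`--supports stmt-BirchSwinnertonDyer-25235`). The Literature proof file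
`HeegnerModuleScalingProofs` computes the Heegner module of a rescaled parametrisation for `p ∤ m` and
names the missing input for `m = p`: «levelwise `p`-divisibility inside `𝔖_p` — not attempted». This
file supplies it:

* §1 `compatiblePi_eq_zero_of_smul_eq_zero` / `_of_pow_smul_eq_zero`: if `E(L)[p] = 0` (`L = K̄^H`)
  then the group of `p_*`-compatible families `lim←_k H¹(H, E[p^k])` (`compatiblePi`) has no
  `p`-torsion — a family killed by `p` dies in `H¹(H, E(K̄))`, so it is levelwise Kummer
  (`exists_kummerFamily_apply_eq_of_pow_smul_eq_zero`), `x_k = δ_k(P_{k+1})` with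
  `p • δ_{k+1}(P_{k+1}) = 0`, whence `P_{k+1} ∈ p^k E(L)` and `x_k = 0`.
* §2 `conj_σ` and `res` preserve `compatiblePi`, `conj_σ` the compact Selmer group `compactSelmerOver`
  (functoriality of `p_*`; Selmer stability `conjH1_mem_selmerTorsionOver`); the `ℤ_p`-multiples are
  `RamifiedSevenEllipticUnits.KummerFamiliesSelmer.padicPi_mem_compactSelmerOver` (landed, reused in part III).
* §3 `exists_proj_eq_and_pow_smul_eq`: DIVISION BY `p^a` IN `𝔖_p(K_∞) = lim←_n S_p(E/K_n)`
  (`LambdaAdicSelmerData`) — if every projection of `s` is `p^a • t_n` with `t_n ∈ S_p(E/K_n)` and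
  `E(K_n)[p] = 0` for all `n`, then `s = p^a • s'` with `proj_n s' = t_n` (the `t_n` are
  norm-compatible because their defect is a compatible family killed by `p^a`; then `surj`, `ext`);
  `eq_zero_of_natCast_smul_eq_zero`: `𝔖` has no `p`-torsion.

HONEST FRAMING: cohomological bookkeeping over the tree's definitions; no named fact; no arithmetic
input; closes nothing by itself. Parts II (`PrintX9RescalingCharIdealPow`) and III
(`PrintX9HowardContainmentOfPrintRescaling`) use it to show `ℋ_∞(p^a • F) = p^a · ℋ_∞(F)` and that the
`∃ F`-typed Howard containment absorbs the `μ`-part by rescaling the parametrisation.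

References: B. Perrin-Riou, Bull. SMF 115 (1987) §0 pp. 401–402 (`S_p(L) = lim← S(L)^{(p^k)}`,
`𝔖_p = lim← S_p(K_n)`); B. Howard, Compositio 140 (2004) §1 (the descent sequence
`0 → E(L) ⊗ ℤ_p → S_p(E/L) → …`); J. Silverman, AEC VIII.§2 (the Kummer sequence).
-/

set_option linter.dupNamespace false
set_option autoImplicit false

noncomputable section

open scoped Classical Pointwise

universe u

open WeierstrassCurve Literature.NumberTheory.EllipticCurves
  Literature.NumberTheory.EllipticCurves.ModularForms

namespace Summit.BirchSwinnertonDyer.BirchSwinnertonDyer.Theorems.PrintX9Rescaling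

/-! ## §1 `lim←_k H¹(H, E[p^k])` has no `p`-torsion when `E(L)[p] = 0` -/

section CompatibleTorsionFree

variable {F : Type u} [Field F] (V : WeierstrassCurve F) [V.IsElliptic] (p : ℕ) [Fact p.Prime]
  (H : Subgroup (Field.absoluteGaloisGroup F))

/-- **No `p`-torsion in the compatible families when `E(L)[p] = 0`.** If `x = (x_k) ∈ ∏_k H¹(H, E[p^k])`
is `p_*`-compatible and `p • x = 0`, then `x = 0`: each `x_k` dies in `H¹(H, E(K̄))` (its image is
`ι(p • x_k) = 0` after one transition step), so `x_k = δ_k(P_k)` for `L`-rational `P_k`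
(`exists_kummerFamily_apply_eq_of_pow_smul_eq_zero`); `p • δ_{k+1}(P_{k+1}) = 0` gives
`p • P_{k+1} ∈ p^{k+1} E(L)`, hence `P_{k+1} ∈ p^k E(L)` as `E(L)[p] = 0`, and
`x_k = p_* x_{k+1} = δ_k(P_{k+1}) = 0`. (The torsion of `lim← H¹(L, E[p^k]) = H¹(L, T_pE)` is `E(L)[p^∞]`-controlled.)
[cite: PerrinRiou1987BSMF, §0 p. 401 (S_p(L) = lim← S(L)^{(p^k)})] [cite: SilvermanAEC2009, VIII.§2 (the Kummer sequence)] -/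
theorem compatiblePi_eq_zero_of_smul_eq_zero
    (hnt : ∀ P ∈ V.fixedGeomPoints H, (p : ℤ) • P = 0 → P = 0)
    {x : V.torsionH1Pi p H} (hx : x ∈ V.compatiblePi H p) (h : (p : ℤ) • x = 0) : x = 0 := by
  have hk : ∀ k, (p : ℤ) • x k = 0 := fun k ↦ by
    have := congrFun h k
    rwa [Pi.smul_apply, Pi.zero_apply] at this
  -- every component dies in `H¹(H, E(K̄))`
  have hSha : ∀ k, p ^ 1 • V.torsionToGeomH1Over ((p : ℤ) ^ k) H (x k) = 0 := fun k ↦ by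
    rw [pow_one, ← map_nsmul, ← natCast_zsmul, hk k, map_zero]
  choose P hP using fun k ↦ V.exists_kummerFamily_apply_eq_of_pow_smul_eq_zero p H hx 1 hSha k
  -- `P_{k+1} ∈ p^k E(L)`
  have hdiv : ∀ k, ∃ R : V.fixedGeomPoints H, ((p : ℤ) ^ k) • R = P (k + 1) := fun k ↦ by
    have h0 : V.kummerFamily p H ((p : ℤ) • P (k + 1)) (k + 1) = 0 := by
      rw [← kummerFamilyHom_apply, map_zsmul, Pi.smul_apply, kummerFamilyHom_apply, ← hP (k + 1),
        hk (k + 1)]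
    obtain ⟨R, hR⟩ := (V.kummerFamily_apply_eq_zero_iff p H _ (k + 1)).1 h0
    refine ⟨R, ?_⟩
    have h1 : (p : ℤ) • (((p : ℤ) ^ k) • R - P (k + 1)) = 0 := by
      rw [smul_sub, smul_smul, ← pow_succ', hR, sub_self]
    have h2 : (((p : ℤ) ^ k) • R - P (k + 1) : V.fixedGeomPoints H) = 0 := by
      have h3 := hnt _ ((((p : ℤ) ^ k) • R - P (k + 1) : V.fixedGeomPoints H)).2
        (by rw [← AddSubgroupClass.coe_zsmul, h1]; rfl)
      exact_mod_cast h3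
    exact sub_eq_zero.mp h2
  funext k
  obtain ⟨R, hR⟩ := hdiv k
  rw [Pi.zero_apply, ← (mem_compatiblePi_iff.1 hx) k, hP (k + 1),
    IsKummerFamilyOver.reduceTorsionH1 p (V.isKummerFamilyOver_kummerFamily p H (P (k + 1))) k,
    V.kummerFamily_apply_eq_zero_iff p H]
  exact ⟨R, hR⟩

/-- Iteration: `p^a • x = 0` forces `x = 0` on `compatiblePi` when `E(L)[p] = 0`.
[cite: PerrinRiou1987BSMF, §0 p. 401 (S_p(L) = lim← S(L)^{(p^k)})] -/
theorem compatiblePi_eq_zero_of_pow_smul_eq_zero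
    (hnt : ∀ P ∈ V.fixedGeomPoints H, (p : ℤ) • P = 0 → P = 0) (a : ℕ)
    {x : V.torsionH1Pi p H} (hx : x ∈ V.compatiblePi H p) (h : ((p : ℤ) ^ a) • x = 0) : x = 0 := by
  induction a generalizing x with
  | zero => rwa [pow_zero, one_smul] at h
  | succ a ih =>
    have h' : ((p : ℤ) ^ a) • ((p : ℤ) • x) = 0 := by rw [smul_smul, ← pow_succ, h]
    have hpx : (p : ℤ) • x = 0 := ih (AddSubgroup.zsmul_mem _ hx _) h'
    exact compatiblePi_eq_zero_of_smul_eq_zero V p H hnt hx hpx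

end CompatibleTorsionFree

/-! ## §2 `conj_σ`, `res` preserve compatibility and the compact Selmer group -/

section Functoriality

variable {K : Type u} [Field K] (V : WeierstrassCurve K) (p : ℕ)
  (H : Subgroup (Field.absoluteGaloisGroup K))

/-- `p_*` commutes with restriction along `H ≤ H'` (both are maps of compatible pairs).
[cite: PerrinRiou1987BSMF, §0 p. 401 (transition and restriction maps of S_p)] -/
theorem reduceTorsionH1_resOfLe {H H' : Subgroup (Field.absoluteGaloisGroup K)} (h : H ≤ H') (k : ℕ)
    (x : V.torsionH1Over ((p : ℤ) ^ (k + 1)) H') :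
    V.reduceTorsionH1 p k H
        (Literature.NumberTheory.EllipticCurves.resOfLe (geomTorsion V ((p : ℤ) ^ (k + 1))) h x) =
      Literature.NumberTheory.EllipticCurves.resOfLe (geomTorsion V ((p : ℤ) ^ k)) h
        (V.reduceTorsionH1 p k H' x) := by
  change ((V.reduceTorsionH1 p k H).comp
      (Literature.NumberTheory.EllipticCurves.resOfLe (geomTorsion V ((p : ℤ) ^ (k + 1))) h)) x =
    ((Literature.NumberTheory.EllipticCurves.resOfLe (geomTorsion V ((p : ℤ) ^ k)) h).comp
      (V.reduceTorsionH1 p k H')) x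
  congr 1
  rw [WeierstrassCurve.reduceTorsionH1, WeierstrassCurve.reduceTorsionH1,
    Literature.NumberTheory.EllipticCurves.resOfLe, Literature.NumberTheory.EllipticCurves.resOfLe,
    resH1Hom_comp, resH1Hom_comp]
  exact resH1Hom_congr (by ext; rfl) (by ext; rfl) _ _

/-- `conj_σ` preserves the `p`-compatible families (`p_*` commutes with `conj_σ`).
[cite: PerrinRiou1987BSMF, §0 pp. 400–402] -/
theorem conjPi_mem_compatiblePi [H.Normal] (σ : Field.absoluteGaloisGroup K) {x : V.torsionH1Pi p H}
    (hx : x ∈ V.compatiblePi H p) : V.conjPi p H σ x ∈ V.compatiblePi H p := by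
  rw [mem_compatiblePi_iff] at hx ⊢
  intro k
  simp only [WeierstrassCurve.conjPi, AddMonoidHom.pi_apply, AddMonoidHom.coe_comp,
    Function.comp_apply, Pi.evalAddMonoidHom_apply]
  rw [LambdaAdicSelmerDataExists.reduceTorsionH1_conjH1, hx k]

/-- `res` preserves the `p`-compatible families (`p_*` commutes with `res`).
[cite: PerrinRiou1987BSMF, §0 pp. 401–402] -/
theorem resPi_mem_compatiblePi {H H' : Subgroup (Field.absoluteGaloisGroup K)} (h : H ≤ H')
    {x : V.torsionH1Pi p H'} (hx : x ∈ V.compatiblePi H' p) : V.resPi p h x ∈ V.compatiblePi H p := by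
  rw [mem_compatiblePi_iff] at hx ⊢
  intro k
  simp only [WeierstrassCurve.resPi, AddMonoidHom.pi_apply, AddMonoidHom.coe_comp,
    Function.comp_apply, Pi.evalAddMonoidHom_apply]
  rw [reduceTorsionH1_resOfLe, hx k]

section Selmer

variable [NumberField K] [H.Normal]

/-- The compact Selmer group consists of compatible families (second half of its definition).
[cite: PerrinRiou1987BSMF, §0 p. 401] -/
theorem compatiblePi_of_mem_compactSelmerOver {x : V.torsionH1Pi p H}
    (hx : x ∈ V.compactSelmerOver H p) : x ∈ V.compatiblePi H p :=
  mem_compatiblePi_iff.2 ((V.mem_compactSelmerOver_iff H p x).1 hx).2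

/-- `conj_σ` preserves the compact Selmer group (Selmer at each level: `conjH1_mem_selmerTorsionOver`;
compatibility: `reduceTorsionH1_conjH1`). [cite: PerrinRiou1987BSMF, §0 pp. 400–402] -/
theorem conjPi_mem_compactSelmerOver (σ : Field.absoluteGaloisGroup K) {x : V.torsionH1Pi p H}
    (hx : x ∈ V.compactSelmerOver H p) : V.conjPi p H σ x ∈ V.compactSelmerOver H p := by
  have hc := conjPi_mem_compatiblePi V p H σ (compatiblePi_of_mem_compactSelmerOver V p H hx)
  rw [WeierstrassCurve.mem_compactSelmerOver_iff] at hx ⊢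
  refine ⟨fun k ↦ ?_, mem_compatiblePi_iff.1 hc⟩
  simp only [WeierstrassCurve.conjPi, AddMonoidHom.pi_apply, AddMonoidHom.coe_comp,
    Function.comp_apply, Pi.evalAddMonoidHom_apply]
  exact LambdaAdicSelmerDataExists.conjH1_mem_selmerTorsionOver V H ((p : ℤ) ^ k) σ (hx.1 k)

end Selmer

end Functoriality

/-! ## §3 Division by `p^a` in `𝔖_p(K_∞)` -/

section Division

variable {K : Type u} [Field K] [NumberField K] {V : WeierstrassCurve K} [V.IsElliptic] {p : ℕ}
  [Fact p.Prime] {κ : ZpExtension K p} {γ : Field.absoluteGaloisGroup K}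

/-- The constant `(p : Λ)^a` is `C (p^a)`. [folklore] -/
theorem natCast_pow_eq_C (a : ℕ) :
    ((p : IwasawaAlgebra p) ^ a) = PowerSeries.C ((((p : ℤ) ^ a : ℤ)) : ℤ_[p]) := by
  rw [Int.cast_pow, Int.cast_natCast, map_pow, map_natCast]

/-- **Division by `p^a` in `𝔖_p(K_∞) = lim←_n S_p(E/K_n)`.** If `E(K_n)[p] = 0` for every layer and the
projections of `s ∈ 𝔖` are `proj_n s = p^a • t_n` with `t_n ∈ S_p(E/K_n)`, then `s = p^a • s'` for an
`s' ∈ 𝔖` with `proj_n s' = t_n`: the norm-compatibility defect of `(t_n)` is a compatible family killed by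
`p^a` (`proj_norm`), hence zero (§1); then `surj` and `ext`.
[cite: PerrinRiou1987BSMF, §0 p. 402 (𝔖_p = lim← S_p(K_n) along corestriction)] -/
theorem exists_proj_eq_and_pow_smul_eq (D : V.LambdaAdicSelmerData κ γ)
    (hnt : ∀ n, ∀ P ∈ V.fixedGeomPoints (κ.layerSubgroup n), (p : ℤ) • P = 0 → P = 0)
    (a : ℕ) (s : D.S) (t : Π n : ℕ, V.torsionH1Pi p (κ.layerSubgroup n))
    (ht : ∀ n, t n ∈ V.compactSelmerOver (κ.layerSubgroup n) p)
    (hts : ∀ n, ((p : ℤ) ^ a) • t n = D.proj n s) :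
    ∃ s' : D.S, (∀ n, D.proj n s' = t n) ∧ ((p : IwasawaAlgebra p) ^ a) • s' = s := by
  have hnorm : ∀ n, V.resPi p (κ.layerSubgroup_antitone (Nat.le_succ n)) (t n) =
      ∑ i ∈ Finset.range p, V.conjPi p (κ.layerSubgroup (n + 1)) (γ ^ (p ^ n * i)) (t (n + 1)) := by
    intro n
    rw [← sub_eq_zero]
    refine compatiblePi_eq_zero_of_pow_smul_eq_zero V p (κ.layerSubgroup (n + 1)) (hnt (n + 1)) a
      (sub_mem (resPi_mem_compatiblePi V p _
          (compatiblePi_of_mem_compactSelmerOver V p _ (ht n)))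
        (AddSubgroup.sum_mem _ fun i _ ↦ conjPi_mem_compatiblePi V p _ _
          (compatiblePi_of_mem_compactSelmerOver V p _ (ht (n + 1))))) ?_
    rw [← zsmulAddGroupHom_apply, map_sub, map_sum, zsmulAddGroupHom_apply, ← map_zsmul, hts n,
      D.proj_norm n s, sub_eq_zero]
    refine Finset.sum_congr rfl fun i _ ↦ ?_
    rw [zsmulAddGroupHom_apply, ← map_zsmul, hts]
  obtain ⟨s', hs'⟩ := D.surj t ht hnorm
  refine ⟨s', hs', ?_⟩
  rw [← sub_eq_zero]
  refine D.ext _ fun n ↦ ?_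
  rw [map_sub, sub_eq_zero, natCast_pow_eq_C, D.proj_C, padicPi_intCast, hs' n, hts n]

/-- **`𝔖_p(K_∞)` has no `p`-torsion when `E(K_n)[p] = 0` along the tower** (its projections live in the
`p`-torsion-free `compatiblePi`, and they are jointly injective). [cite: PerrinRiou1987BSMF, §0 p. 402] -/
theorem eq_zero_of_natCast_smul_eq_zero (D : V.LambdaAdicSelmerData κ γ)
    (hnt : ∀ n, ∀ P ∈ V.fixedGeomPoints (κ.layerSubgroup n), (p : ℤ) • P = 0 → P = 0)
    {s : D.S} (hs : (p : IwasawaAlgebra p) • s = 0) : s = 0 := by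
  refine D.ext s fun n ↦ compatiblePi_eq_zero_of_smul_eq_zero V p _ (hnt n)
    (compatiblePi_of_mem_compactSelmerOver V p _ (D.proj_mem n s)) ?_
  rw [← padicPi_intCast, ← D.proj_C, Int.cast_natCast, map_natCast, hs, map_zero]

end Division

end Summit.BirchSwinnertonDyer.BirchSwinnertonDyer.Theorems.PrintX9Rescaling

end
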